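import Summits.BirchSwinnertonDyer.Rank1Residual.X10.ResidualSelmerGeneratorTestInstance
import Summits.BirchSwinnertonDyer.Rank1Residual.Additive.IntModelTamagawaCertificate
import HarnessLib

/-!
# The `E[p]` instance of the N2 parity law over `ℚ`: the census binders of the NO-GO form as ONE
# `decide`-able row check on the integral model (Tate's algorithm row certificate)
# (cell `b2b-bsdres`, unit `b2b-bsdres-x10` = N2 class lead, GEN 32; theorems only, no definition,
# ONE named-fact hypothesis `poitouTate_selmerStructure_duality ℚ` (→ conditional), nothing booked)

HONEST FRAMING (run/shared/lean/b2b/bsd-rank1-residual/, verbatim in every file): the goal of the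
cell is to DELETE the COMBINATION-SHAPED residual classes of the Birch–Swinnerton-Dyer formula for
ALL analytic-rank `≤ 1` elliptic curves over `ℚ` — "full BSD formula for every rank `≤ 1` curve in
class `C`" assembled STRICTLY from published theorems — so that the rank-`≤ 1` remainder becomes
exactly the CONSTRUCTION-SHAPED classes, which are TYPED (missing-input `Prop`s), NOT attempted.
This is not "finishing BSD". Class X10b (= N2) keeps its label CONSTRUCTION-SHAPED (NEEDS `X_A3`,
referee R82.3 / RESIDUAL-MAP §I N2); this file is a TOOL; no mark / label / tier / count moves.

## What

x10 GEN 31 landed Mazur–Rubin's parity law (P) for `H¹(K, E[p])` over any number field `K`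
(`X10/ResidualSelmerParityInstance.lean`: `residualSelmerGroup_ne_bot_of_odd_of_split` — for
`S ⊇ {v ∣ ∞} ∪ {v ∣ p} ∪ {bad v}`, `T ⊆ S` the split multiplicative `v ∤ p` with `p ∣ c_v`, every
other finite `v ∈ S`, `v ∤ p`, Tamagawa-`p`-free: `#Sel_p(E) = p^s`, `s + #T` odd ⟹ `S⁰(E) ≠ ⊥`),
conditional only on the Poitou–Tate fact. Its hypotheses are indexed by PLACES. For a curve over `ℚ`
given by a globally minimal equation `W` with integral model `E₀` (`integralModelInt W = E₀`, the
record currency of `X10/UnitRoadTamCert*`, `X10/UnitCompanionRecords*`) this file turns ALL the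
place-indexed census binders into ONE Boolean check on `E₀`, decided by `decide +kernel` per cell:

* the rank-2 observatory's ROW CERTIFICATE `TamLocal.rowCheck Es E₀` of Tate's algorithm
  (`Rank2ObservatoryTamagawaLocal/Cert`: every bad prime listed — `|Δ(E₀)| = ∏ pⁿ` —, each local
  certificate checked: split `Iₙ` by a root of the node-tangent quadratic (`c = n`), non-split by
  exhaustion / Euler (`c ∈ {1, 2}`), additive by a Step-2 / deep Tate certificate with the tree's
  PROVED value set of the Kodaira type; ONE soundness theorem per stage, NO named fact);
* the SIDE CHECK `Es.all (E ↦ E.p = p ∨ (E.kind = 1 ∧ p ∣ E.n) ∨ ∀ c ∈ E.vals, p ∤ c)`: every bad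
  prime `ℓ ≠ p` is either a `T`-prime (split multiplicative, `p ∣ n = c_ℓ`) or has its whole certified
  value set prime to `p` (so `p ∤ c_ℓ` whatever the exact value);
* `k = #{E ∈ Es : E.kind = 1 ∧ p ∣ E.n ∧ E.p ≠ p} = #T_E`.

Then (§3) **`residualSelmerGroup_ne_bot_of_rowCheck`**: `#Sel_p(E) = p^s`, `s + k` odd ⟹
`S⁰(E) ≠ ⊥`, with `S = {∞, p} ∪ {bad ℓ}` and `T = T_E` built from the row (§1: places of `𝓞 ℚ` named
by naturals, `Rank2ObservatoryTamagawaCert.pl`; §2: split multiplicative reduction and `c_v = n` read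
off a kind-`1` local certificate). DISPLAYED: the fact `hfact`, the census `#Sel_p(E) = p^s`; everything
`E`-side is the kernel check. (§4) the same dictionary for the generator test (G) at one exceptional
place (`ResidualSelmerGeneratorTestInstance.generatorTest_of_split`): `generatorTest_of_rowCheck`, with
the exceptional prime `ℓ₀` named by a natural and the Selmer generator `c` / its ramification at `ℓ₀`
displayed. Records: `X10/ResidualSelmerParityRecords*.lean` (the 73 parity-odd N2 cells, among them
the 25 NOGO-parity cells of the TRIVIAL-ROADS memo). Nothing booked; N2 stays CONSTRUCTION-SHAPED.

References: [MazurRubin2007] Def. 1.2, Prop. 1.3 (i), Thm. 1.4; [KlagsbrunMazurRubin2013] Thm. 3.9;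
[SilvermanATAEC1994] IV.9.4; [SilvermanAEC2009] VII.1 Rem. 1.1, VII.5 Prop. 5.1; [Tate1975] §7;
HOME/class-closure/N2/TRIVIAL-ROADS-x10g27.md; HOME/X10-AUDIT.md §§36–38.
-/

set_option autoImplicit false

noncomputable section

open scoped Classical

open Function WeierstrassCurve Field Literature.NumberTheory.EllipticCurves
  Literature.NumberTheory.GaloisRepresentations Literature.NumberTheory.GaloisCohomology NumberField
  IsDedekindDomain Rat.HeightOneSpectrum
open Literature.NumberTheory.GaloisRepresentations.DiscreteGaloisModule (unramifiedSubgroup)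
open Summit.BirchSwinnertonDyer.BirchSwinnertonDyer.Rank2Observatory.Tam
open Summit.BirchSwinnertonDyer.Rank1Residual.Additive
open Summit.BirchSwinnertonDyer.Rank1Residual.X10.ResidualSelmerGroup
open Summit.BirchSwinnertonDyer.Rank1Residual.X10.ResidualSelmerParityInstance
open Summit.BirchSwinnertonDyer.Rank1Residual.X10.ResidualSelmerGeneratorTestInstance

namespace Summit.BirchSwinnertonDyer.Rank1Residual.X10.ResidualSelmerParityRat

/-! ### §1. Places of `𝓞 ℚ` named by naturals -/

/-- `q ∈ 𝔭_v ↔ p_v = q` for a rational prime `q`. [folklore] -/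
theorem natCast_mem_asIdeal_iff_natGenerator_eq {q : ℕ} (hq : q.Prime) (v : HeightOneSpectrum (𝓞 ℚ)) :
    (q : 𝓞 ℚ) ∈ v.asIdeal ↔ natGenerator v = q := by
  rw [Rat.natCast_mem_asIdeal_iff, Nat.prime_dvd_prime_iff_eq (prime_natGenerator v) hq]

/-- The finite place `v` lies in the set of places named by a list of primes `L` iff `p_v ∈ L`.
[folklore] -/
theorem inr_mem_image_iff {L : List ℕ} (hL : ∀ q ∈ L, q.Prime) (v : HeightOneSpectrum (𝓞 ℚ)) :
    (Sum.inr v : Place ℚ) ∈ L.toFinset.image (fun q => (Sum.inr (pl q) : Place ℚ)) ↔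
      natGenerator v ∈ L := by
  simp only [Finset.mem_image, List.mem_toFinset]
  constructor
  · rintro ⟨q, hq, hqv⟩
    rw [← Sum.inr_injective hqv, natGenerator_pl (hL q hq)]
    exact hq
  · intro hv
    exact ⟨natGenerator v, hv, by rw [pl_natGenerator]⟩

/-- No archimedean place is named by a list of primes. [folklore] -/
theorem inl_not_mem_image (L : List ℕ) (w : InfinitePlace ℚ) :
    (Sum.inl w : Place ℚ) ∉ L.toFinset.image (fun q => (Sum.inr (pl q) : Place ℚ)) := by
  intro h
  obtain ⟨q, -, hq⟩ := Finset.mem_image.mp h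
  exact Sum.inr_ne_inl hq

/-- A duplicate-free list of primes names as many places. [folklore] -/
theorem card_image_eq_length {L : List ℕ} (hL : ∀ q ∈ L, q.Prime) (hnd : L.Nodup) :
    (L.toFinset.image (fun q => (Sum.inr (pl q) : Place ℚ))).card = L.length := by
  rw [Finset.card_image_of_injOn, List.toFinset_card_of_nodup hnd]
  intro a ha b hb hab
  have ha' : a ∈ L := List.mem_toFinset.mp (Finset.mem_coe.mp ha)
  have hb' : b ∈ L := List.mem_toFinset.mp (Finset.mem_coe.mp hb)
  have h : pl a = pl b := Sum.inr_injective hab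
  rw [← natGenerator_pl (hL a ha'), h, natGenerator_pl (hL b hb')]

/-! ### §2. Reading a kind-`1` local certificate: split multiplicative, `c_v = n` -/

/-- **Split multiplicative reduction from a checked kind-`1` local certificate** (`p ∤ c₄(E₀)` and a
root of the node-tangent quadratic modulo `p`; Silverman VII.5.1(b) via the observatory's
`hasSplitMultiplicativeReductionAt_int_iff`). [cite: SilvermanAEC2009, VII.5 Prop. 5.1(b)] -/
theorem hasSplitMultiplicativeReductionAt_of_check {W₀ : WeierstrassCurve ℤ} [(W₀.baseChange ℚ).IsElliptic]
    {E : TamLocal} (hc : E.check W₀ = true) (h1 : E.kind = 1) (v : HeightOneSpectrum (𝓞 ℚ))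
    (hv : natGenerator v = E.p) : (W₀.baseChange ℚ).HasSplitMultiplicativeReductionAt v := by
  obtain ⟨hp, hn1, ⟨hΔn, -⟩, -⟩ := TamLocal.check_common hc
  haveI : Fact E.p.Prime := ⟨hp⟩
  have hΔ1 : (E.p : ℤ) ∣ W₀.Δ := (dvd_pow_self _ (by omega)).trans hΔn
  simp only [TamLocal.check, Bool.and_eq_true, Bool.or_eq_true, beq_iff_eq, decide_eq_true_eq,
    List.all_eq_true, Bool.not_eq_true', decide_eq_false_iff_not, List.mem_range] at hc
  obtain ⟨-, hk⟩ := hc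
  rcases hk with (((⟨⟨-, hc4⟩, hw⟩ | ⟨⟨h2, -⟩, -⟩) | ⟨⟨⟨h3, -⟩, -⟩, -⟩) | ⟨h4, -⟩) | ⟨h5, -⟩
  · exact (hasSplitMultiplicativeReductionAt_int_iff hv hΔ1 hc4).mpr (splits_nodalPoly_of_dvd hc4 hw)
  all_goals omega

/-- **`c_v = n = ord_v Δ` from a checked kind-`1` local certificate** of a row (for `W₀ ⊗ ℚ` globally
minimal): the certified value set of a split place is `{n}`. [cite: SilvermanATAEC1994, IV.9.4 Step 2] -/
theorem tam_eq_n_of_kind_one {Es : List TamLocal} {W₀ : WeierstrassCurve ℤ}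
    (hrow : TamLocal.rowCheck Es W₀ = true) (hGM : (W₀.baseChange ℚ).IsGloballyMinimal)
    {E : TamLocal} (hE : E ∈ Es) (h1 : E.kind = 1) (v : HeightOneSpectrum (𝓞 ℚ))
    (hv : natGenerator v = E.p) : tam W₀ v = E.n := by
  have hm := TamLocal.tam_mem_vals_of_mem hrow hGM hE v hv
  rw [TamLocal.vals, if_pos h1, List.mem_singleton] at hm
  exact hm

/-- **`p ∤ c_v` from a certified value set prime to `p`** (any kind; for `W₀ ⊗ ℚ` globally minimal).
[cite: SilvermanATAEC1994, IV.9.4] -/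
theorem not_dvd_tam_of_vals {Es : List TamLocal} {W₀ : WeierstrassCurve ℤ}
    (hrow : TamLocal.rowCheck Es W₀ = true) (hGM : (W₀.baseChange ℚ).IsGloballyMinimal)
    {E : TamLocal} (hE : E ∈ Es) {p : ℕ} (hvals : ∀ c ∈ E.vals, ¬ p ∣ c) (v : HeightOneSpectrum (𝓞 ℚ))
    (hv : natGenerator v = E.p) : ¬ p ∣ tam W₀ v :=
  hvals _ (TamLocal.tam_mem_vals_of_mem hrow hGM hE v hv)

/-- **Good reduction at an unlisted place** (`p_v ∤ Δ(E₀)` by completeness of the row;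
Silverman VII.5.1(a)). [cite: SilvermanAEC2009, VII.5 Prop. 5.1(a)] -/
theorem hasGoodReductionAt_of_not_mem {Es : List TamLocal} {W₀ : WeierstrassCurve ℤ}
    (hrow : TamLocal.rowCheck Es W₀ = true) (v : HeightOneSpectrum (𝓞 ℚ))
    (hv : natGenerator v ∉ Es.map (·.p)) : (W₀.baseChange ℚ).HasGoodReductionAt v := by
  have hΔ : ¬ ((natGenerator v : ℕ) : ℤ) ∣ W₀.Δ := fun hd =>
    hv (TamLocal.mem_of_prime_dvd hrow (prime_natGenerator v) hd)
  exact hasGoodReductionAt_of_valuation_Δ_eq_one_holds (v := v) (W := W₀.baseChange ℚ)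
    (isIntegralAt_int W₀ v) (by rw [baseChange_int_Δ]; exact Rat.valuation_intCast_eq_one v hΔ)

/-! ### §3. The NO-GO form of (P) over `ℚ` from ONE row check -/

/-- **(P), NO-GO form for `E[p]` over `ℚ`, census binders IN THE KERNEL.** Let `p` be an odd prime,
`W / ℚ` globally minimal with integral model `E₀`, `Es` a Tate-algorithm ROW CERTIFICATE of `E₀`
(`TamLocal.rowCheck`: all bad primes, each local certificate checked), and suppose the SIDE CHECK:
every listed prime `ℓ` has `ℓ = p`, or is split multiplicative with `p ∣ n = c_ℓ` (kind `1`), or has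
its certified value set prime to `p`. Let `k` be the number of listed `ℓ ≠ p` of kind `1` with
`p ∣ n` (`= #T_E`). If `#Sel_p(E) = p^s` with `s + k` odd, then `S⁰(E) ≠ ⊥` — Mazur–Rubin's parity law
(`ResidualSelmerParityInstance.residualSelmerGroup_ne_bot_of_odd_of_split`) with
`S = {∞, p} ∪ {bad ℓ}`, `T = T_E`, and `hS`/`hSp`/`hSbad`/`hTS`/`hT`/`hTp`/`hTsplit`/`htam` ALL
discharged from the row. CONDITIONAL on the Poitou–Tate fact `hfact` only; `hs` is census.
[cite: MazurRubin2007, Prop. 1.3 (i) and Thm. 1.4] [cite: KlagsbrunMazurRubin2013, Thm. 3.9]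
[cite: SilvermanATAEC1994, IV.9.4] -/
theorem residualSelmerGroup_ne_bot_of_rowCheck (p : ℕ) [hp : Fact p.Prime] (hp2 : p ≠ 2)
    (hfact : poitouTate_selmerStructure_duality ℚ)
    (W : WeierstrassCurve ℚ) [W.IsElliptic] [W.IsGloballyMinimal] {E₀ : WeierstrassCurve ℤ}
    (hI : integralModelInt W = E₀) {Es : List TamLocal} (hrow : TamLocal.rowCheck Es E₀ = true)
    (hside : (Es.all fun E => decide (E.p = p) || decide (E.kind = 1 ∧ p ∣ E.n) ||
      E.vals.all fun c => !decide (p ∣ c)) = true)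
    {k : ℕ} (hk : (Es.filter fun E => decide (E.kind = 1 ∧ p ∣ E.n ∧ E.p ≠ p)).length = k)
    {s : ℕ} (hs : Nat.card (W.selmerGroup (p : ℤ)) = p ^ s) (hodd : Odd (s + k)) :
    residualSelmerGroup W p ≠ ⊥ := by
  have hW := IntModelTam.eq_baseChange_of_integralModelInt hI
  subst hW
  have hGM : (E₀.baseChange ℚ).IsGloballyMinimal := ‹_›
  obtain ⟨hall, hnd, -⟩ := TamLocal.rowCheck_spec hrow
  have hprime : ∀ q ∈ Es.map (·.p), q.Prime := fun q hq => TamLocal.prime_of_mem_map hrow hq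
  -- the lists of primes naming `S` and `T`
  set L : List ℕ := p :: Es.map (·.p) with hLdef
  have hL : ∀ q ∈ L, q.Prime := by
    intro q hq
    rcases List.mem_cons.mp hq with rfl | hq
    · exact hp.out
    · exact hprime q hq
  set L' : List ℕ := (Es.filter fun E => decide (E.kind = 1 ∧ p ∣ E.n ∧ E.p ≠ p)).map (·.p)
    with hL'def
  have hL'sub : L'.Sublist (Es.map (·.p)) := by
    rw [hL'def]
    exact (List.filter_sublist (l := Es)).map (fun E : TamLocal => E.p)
  have hL' : ∀ q ∈ L', q.Prime := fun q hq => hprime q (hL'sub.subset hq)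
  have hL'nd : L'.Nodup := hnd.sublist hL'sub
  -- membership in `L'` unpacked
  have hmemL' : ∀ {q : ℕ}, q ∈ L' ↔ ∃ E ∈ Es, (E.kind = 1 ∧ p ∣ E.n ∧ E.p ≠ p) ∧ E.p = q := by
    intro q
    simp only [hL'def, List.mem_map, List.mem_filter, decide_eq_true_eq]
    constructor
    · rintro ⟨E, ⟨hE, hP⟩, hq⟩; exact ⟨E, hE, hP, hq⟩
    · rintro ⟨E, hE, hP, hq⟩; exact ⟨E, ⟨hE, hP⟩, hq⟩
  set S : Finset (Place ℚ) :=
    Finset.univ.image (Sum.inl : InfinitePlace ℚ → Place ℚ) ∪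
      L.toFinset.image (fun q => (Sum.inr (pl q) : Place ℚ)) with hSdef
  set T : Finset (Place ℚ) := L'.toFinset.image (fun q => (Sum.inr (pl q) : Place ℚ)) with hTdef
  have hTcard : T.card = k := by
    rw [hTdef, card_image_eq_length hL' hL'nd, hL'def, List.length_map, hk]
  rw [← hTcard] at hodd
  -- membership of a finite place in `S`
  have hSinr : ∀ v : HeightOneSpectrum (𝓞 ℚ), (Sum.inr v : Place ℚ) ∈ S ↔ natGenerator v ∈ L := by
    intro v
    rw [hSdef, Finset.mem_union, inr_mem_image_iff hL v, Finset.mem_image]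
    constructor
    · rintro (⟨w, -, hw⟩ | h)
      · exact absurd hw Sum.inl_ne_inr
      · exact h
    · exact fun h => Or.inr h
  refine residualSelmerGroup_ne_bot_of_odd_of_split (E₀.baseChange ℚ) p hp2 hfact (S := S) (T := T)
    ?_ ?_ ?_ ?_ ?_ ?_ ?_ ?_ hs hodd
  · -- hS
    intro w
    exact Finset.mem_union_left _ (Finset.mem_image_of_mem _ (Finset.mem_univ w))
  · -- hSp
    intro v hv
    have hv' : natGenerator v = p := (natCast_mem_asIdeal_iff_natGenerator_eq hp.out v).mp hv
    exact (hSinr v).mpr (by rw [hv', hLdef]; exact List.mem_cons_self)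
  · -- hSbad
    intro v hv
    have hvL : natGenerator v ∉ L := fun h => hv ((hSinr v).mpr h)
    exact hasGoodReductionAt_of_not_mem hrow v fun h => hvL (by rw [hLdef]; exact List.mem_cons_of_mem _ h)
  · -- hTS
    intro x hx
    obtain ⟨q, hq, rfl⟩ := Finset.mem_image.mp hx
    have hq' : q ∈ L := by
      rw [hLdef]; exact List.mem_cons_of_mem _ (hL'sub.subset (List.mem_toFinset.mp hq))
    exact Finset.mem_union_right _ (Finset.mem_image.mpr ⟨q, List.mem_toFinset.mpr hq', rfl⟩)
  · -- hT
    intro w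
    exact inl_not_mem_image L' w
  · -- hTp
    intro v hv h3
    obtain ⟨E, -, hP, hq⟩ := hmemL'.mp ((inr_mem_image_iff hL' v).mp hv)
    exact hP.2.2 (hq.trans ((natCast_mem_asIdeal_iff_natGenerator_eq hp.out v).mp h3))
  · -- hTsplit
    intro v hv
    obtain ⟨E, hE, hP, hq⟩ := hmemL'.mp ((inr_mem_image_iff hL' v).mp hv)
    refine ⟨hasSplitMultiplicativeReductionAt_of_check (hall E hE) hP.1 v hq.symm, ?_⟩
    show p ∣ tam E₀ v
    rw [tam_eq_n_of_kind_one hrow hGM hE hP.1 v hq.symm]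
    exact hP.2.1
  · -- htam
    intro v hvS hvT hv3
    have hvL : natGenerator v ∈ L := (hSinr v).mp hvS
    have hvp : natGenerator v ≠ p := fun h => hv3 ((natCast_mem_asIdeal_iff_natGenerator_eq hp.out v).mpr h)
    have hvE : natGenerator v ∈ Es.map (·.p) := by
      rcases List.mem_cons.mp hvL with h | h
      · exact absurd h hvp
      · exact h
    obtain ⟨E, hE, hq⟩ := List.mem_map.mp hvE
    have hsideE := List.all_eq_true.mp hside E hE
    simp only [Bool.or_eq_true, decide_eq_true_eq, List.all_eq_true, Bool.not_eq_true',
      decide_eq_false_iff_not] at hsideE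
    rcases hsideE with (hEp | hkind) | hvals
    · exact absurd (hq.symm.trans hEp) hvp
    · exact absurd ((inr_mem_image_iff hL' v).mpr
        (hmemL'.mpr ⟨E, hE, ⟨hkind.1, hkind.2, fun h => hvp (hq.symm.trans h)⟩, hq⟩)) hvT
    · show ¬ p ∣ tam E₀ v
      exact not_dvd_tam_of_vals hrow hGM hE hvals v hq.symm

/-! ### §4. The generator test (G) over `ℚ` from ONE row check -/

/-- **(G) for `E[p]` over `ℚ` at one exceptional prime `ℓ₀`, census binders IN THE KERNEL.** Let `p`
be an odd prime, `W / ℚ` globally minimal with integral model `E₀`, `Es` a Tate-algorithm ROW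
CERTIFICATE of `E₀`, `ℓ₀ ≠ p` a listed prime of kind `1` (split multiplicative) with `p ∣ n = c_{ℓ₀}`,
and suppose every OTHER listed prime `ℓ ≠ p` has its certified value set prime to `p`. If
`#Sel_p(E) = p` and `0 ≠ c ∈ Sel_p(E)`, then at the place `v₀` of `ℓ₀`: `loc_{v₀} c` RAMIFIED ⟹
`S⁰(E) = ⊥`; `loc_{v₀} c` UNRAMIFIED ⟹ `#S⁰(E) = p²`
(`ResidualSelmerGeneratorTestInstance.generatorTest_of_split` with `S = {∞, p} ∪ {bad ℓ}` and
`hS`/`hSp`/`hSbad`/`hv₀`/`hv₀p`/`hv₀split`/`hv₀c`/`htam` ALL discharged from the row). CONDITIONAL on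
the Poitou–Tate fact; DISPLAYED: `hcard` (census), the class `c` and its ramification at `v₀`.
[cite: MazurRubin2007, Prop. 1.3 (i) and Thm. 1.4] [cite: SilvermanATAEC1994, IV.9.4] -/
theorem generatorTest_of_rowCheck (p : ℕ) [hp : Fact p.Prime] (hp2 : p ≠ 2)
    (hfact : poitouTate_selmerStructure_duality ℚ)
    (W : WeierstrassCurve ℚ) [W.IsElliptic] [W.IsGloballyMinimal] {E₀ : WeierstrassCurve ℤ}
    (hI : integralModelInt W = E₀) {Es : List TamLocal} (hrow : TamLocal.rowCheck Es E₀ = true)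
    {ℓ₀ : ℕ} (hℓ₀ : (Es.any fun E => decide (E.p = ℓ₀ ∧ E.kind = 1 ∧ p ∣ E.n ∧ E.p ≠ p)) = true)
    (hside : (Es.all fun E => decide (E.p = p) || decide (E.p = ℓ₀) ||
      E.vals.all fun c => !decide (p ∣ c)) = true)
    (hcard : Nat.card (W.selmerGroup (p : ℤ)) = p) {c : galH1Torsion W (p : ℤ)}
    (hc : c ∈ W.selmerGroup (p : ℤ)) (hc0 : c ≠ 0) :
    (galoisCohomology.localization (W.torsionGaloisModule (p : ℤ)) (Sum.inr (pl ℓ₀)) 1 c ∉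
        unramifiedSubgroup (GaloisRep.toLocal (pl ℓ₀) (W.torsionGaloisModule (p : ℤ))) 1 →
      residualSelmerGroup W p = ⊥) ∧
    (galoisCohomology.localization (W.torsionGaloisModule (p : ℤ)) (Sum.inr (pl ℓ₀)) 1 c ∈
        unramifiedSubgroup (GaloisRep.toLocal (pl ℓ₀) (W.torsionGaloisModule (p : ℤ))) 1 →
      Nat.card (residualSelmerGroup W p) = p ^ 2) := by
  have hW := IntModelTam.eq_baseChange_of_integralModelInt hI
  subst hW
  have hGM : (E₀.baseChange ℚ).IsGloballyMinimal := ‹_›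
  obtain ⟨hall, -, -⟩ := TamLocal.rowCheck_spec hrow
  have hprime : ∀ q ∈ Es.map (·.p), q.Prime := fun q hq => TamLocal.prime_of_mem_map hrow hq
  -- the exceptional entry
  obtain ⟨E0, hE0, hP0⟩ := List.any_eq_true.mp hℓ₀
  simp only [decide_eq_true_eq] at hP0
  obtain ⟨hE0p, hE0kind, hE0n, hE0ne⟩ := hP0
  have hℓ₀prime : ℓ₀.Prime := hE0p ▸ hprime _ (List.mem_map.mpr ⟨E0, hE0, rfl⟩)
  have hv₀ : natGenerator (pl ℓ₀) = E0.p := by rw [natGenerator_pl hℓ₀prime, hE0p]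
  -- the list of primes naming `S`
  set L : List ℕ := p :: Es.map (·.p) with hLdef
  have hL : ∀ q ∈ L, q.Prime := by
    intro q hq
    rcases List.mem_cons.mp hq with rfl | hq
    · exact hp.out
    · exact hprime q hq
  set S : Finset (Place ℚ) :=
    Finset.univ.image (Sum.inl : InfinitePlace ℚ → Place ℚ) ∪
      L.toFinset.image (fun q => (Sum.inr (pl q) : Place ℚ)) with hSdef
  have hSinr : ∀ v : HeightOneSpectrum (𝓞 ℚ), (Sum.inr v : Place ℚ) ∈ S ↔ natGenerator v ∈ L := by
    intro v
    rw [hSdef, Finset.mem_union, inr_mem_image_iff hL v, Finset.mem_image]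
    constructor
    · rintro (⟨w, -, hw⟩ | h)
      · exact absurd hw Sum.inl_ne_inr
      · exact h
    · exact fun h => Or.inr h
  refine generatorTest_of_split (E₀.baseChange ℚ) p hp2 hfact (S := S) (v₀ := pl ℓ₀)
    ?_ ?_ ?_ ?_ ?_ ?_ ?_ ?_ hcard hc hc0
  · -- hS
    intro w
    exact Finset.mem_union_left _ (Finset.mem_image_of_mem _ (Finset.mem_univ w))
  · -- hSp
    intro v hv
    have hv' : natGenerator v = p := (natCast_mem_asIdeal_iff_natGenerator_eq hp.out v).mp hv
    exact (hSinr v).mpr (by rw [hv', hLdef]; exact List.mem_cons_self)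
  · -- hSbad
    intro v hv
    have hvL : natGenerator v ∉ L := fun h => hv ((hSinr v).mpr h)
    exact hasGoodReductionAt_of_not_mem hrow v fun h => hvL (by rw [hLdef]; exact List.mem_cons_of_mem _ h)
  · -- hv₀
    refine (hSinr (pl ℓ₀)).mpr ?_
    rw [hv₀, hLdef]
    exact List.mem_cons_of_mem _ (List.mem_map.mpr ⟨E0, hE0, rfl⟩)
  · -- hv₀p
    intro h
    exact hE0ne (hv₀.symm.trans ((natCast_mem_asIdeal_iff_natGenerator_eq hp.out _).mp h))
  · -- hv₀split
    exact hasSplitMultiplicativeReductionAt_of_check (hall E0 hE0) hE0kind (pl ℓ₀) hv₀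
  · -- hv₀c
    show p ∣ tam E₀ (pl ℓ₀)
    rw [tam_eq_n_of_kind_one hrow hGM hE0 hE0kind (pl ℓ₀) hv₀]
    exact hE0n
  · -- htam
    intro v hvS hne hv3
    have hvL : natGenerator v ∈ L := (hSinr v).mp hvS
    have hvp : natGenerator v ≠ p := fun h => hv3 ((natCast_mem_asIdeal_iff_natGenerator_eq hp.out v).mpr h)
    have hvℓ : natGenerator v ≠ ℓ₀ := fun h => hne (by rw [← pl_natGenerator v, h])
    have hvE : natGenerator v ∈ Es.map (·.p) := by
      rcases List.mem_cons.mp hvL with h | h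
      · exact absurd h hvp
      · exact h
    obtain ⟨E, hE, hq⟩ := List.mem_map.mp hvE
    have hsideE := List.all_eq_true.mp hside E hE
    simp only [Bool.or_eq_true, decide_eq_true_eq, List.all_eq_true, Bool.not_eq_true',
      decide_eq_false_iff_not] at hsideE
    rcases hsideE with (hEp | hEℓ) | hvals
    · exact absurd (hq.symm.trans hEp) hvp
    · exact absurd (hq.symm.trans hEℓ) hvℓ
    · show ¬ p ∣ tam E₀ v
      exact not_dvd_tam_of_vals hrow hGM hE hvals v hq.symm

end Summit.BirchSwinnertonDyer.Rank1Residual.X10.ResidualSelmerParityRat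

end
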